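import Summits.QuantumFields.BalabanUV.T4Continuum.Spine.NE7c.LiveFactorTowerShell
import Summits.QuantumFields.BalabanUV.T4Continuum.Spine.NE7c.LiveFactorEndLetters
import Summits.QuantumFields.BalabanUV.T4Continuum.Support.B16HistoryTowerExtractionEnd2

/-!
# `T4Continuum.Spine.NE7c.LiveFactorTowerPriced` — spine estimate NE7c (node U5b), road (δ) THRESHOLD RANDOMISATION against
# END2 = IR-103-2 (b) «count DERIVED» (`Support/B16HistoryTowerExtractionPricedDataLWR` p358420 + `Support/B16HistoryTowerExtractionEnd2`,
# leaf-06 g144): (§1) junction J-δ∕IR1032 — file 14's order of quantifiers RE-POINTED at the record `TowerExtractionPricedDataLWR`, whose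
# NE7c rows ⟨shA, shB, Wsh, shell⟩ are byte-identical with IR-103-1's; (§2) END2's ROAD `continuumYM4Torus_of_towerExtractionPriced_fsc`
# APPLIED AT THE LOWERED-THRESHOLD RUN's LETTERS — one moved letter `γ₀ ↦ λ₀²γ₀`, one `exact`
# (cell `pub-balaban-gaps`, track G2, seat ne8 gen 10, file 16; record `HOME/ne/NE7c.md` §17)

HONEST FRAMING.  Finite four-torus programme, rung (B)+1 only — NOT infinite volume, NOT a mass gap, NOT the Clay
problem, NOT summit progress, NOT a proof of NE7c (`T4IndicatorShell.ShellWeightBound`, INSTANCE 0∕1, which waits on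
node O ∕ the (A1c) instance) and NOT a proof of NE7b (`T4WeightBudget.RelWeightBound`, NOT PRINTED, NOT PROVED).  Nothing
of [Bałaban 1983–89] is asserted: threshold randomisation (road (δ)) is the cell's device; END2's record
`TowerExtractionPricedDataLWR` is a displayed HYPOTHESIS SHAPE of the NE7b lineage and its terminal theorem is CITED BY NAME
(nothing of either edited); (B) = `B16.EndStatementBPrinted` and `BetaPertHyp` enter §2 BY NAME as hypotheses, exactly as in
END2.  Everything below is the order of quantifiers over an ABSTRACT tower family (§1) and one instantiation (§2).  Every
input is an explicit hypothesis; no `def`; 0 sorry.  Spine PROVED 0∕9 — unchanged by this file.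

§1 WHAT.  OWNER RULING W-ne7bp1-g104-2 made END2 the END-to-be: its record `TowerExtractionPricedDataLWR D C O θv rr d n hn g₀ os
cΛ M Φ β₀ p₁ η η' κ κ₂ κᵥ P X 𝒢 μ` is IR-103-1's `TowerExtractionDataLWR` with the cell's COUNT block struck and the two PRICE
SENTENCES `priceA ∕ priceB` added; the parameter block and the NE7c rows `shA shB Wsh` ∕ `shell : ShellWeightBound l₀
(HIndex.termSet (skelFam T p₀)) (fun _ t => Repr172R.weight μ (reprFam T p₀ ρ₀ hρ₀ h0 1 _) t) (weightB μ (reprFam T p₀ ρ₀ hρ₀ h0 1 _)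
trunc) shA shB Wsh` are VERBATIM those of IR-103-1.  Hence gen 9's junction (`LiveFactorTowerShell`): §1 (every combinatorial
carrier reads `branch` only) and §2 (`towerShell_of_globalCompact` = the `shell` field's type at the tower `T c⋆`, letter for
letter) apply UNCHANGED, and its §3 is re-typed here against the new record: a THRESHOLD-PARAMETRIC (A1c-0) builder
`build : ∀ c ∈ grid, ∀ Wsh, (shell display at T c) → TowerExtractionPricedDataLWR … P X 𝒢 μ` + `towerShell_of_globalCompact` ⟹
`Nonempty (TowerExtractionPricedDataLWR …)` — the per-(tuned run, loop string) component of the `hRead` of END2's road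
(`nonempty_towerExtractionPriced_of_parametric`; one call `nonempty_towerExtractionPriced_of_globalCompact`).  WHAT THE BUILDER
OWES PER ASSIGNMENT now includes the price sentences `priceA ∕ priceB` at print's shape price `pshapeTH … O C …` — under road (δ)
read at the live letter `{O with γ₀ := λ₀²γ₀}` (§2) — and the extraction displays `extractA ∕ extractB`, by IR-104-2 to be DERIVED
from LCS-j, at live exponents with ONE quotient for the whole grid (`LiveFactorLCS.extractionLaws_of_LCS_live`).

§2 WHAT.  END2's terminal theorem is PARAMETRIC in the constants `C`, `O` and keeps 2R's UNSPLIT slack `C.a + θ ≤ ½γ₀A₁²`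
(binder list = 2R's minus `hsign`).  Road (δ)'s lowered-threshold run moves ONE letter, `O ↦ {O with γ₀ := λ₀²γ₀}`, with the
count's quadratic birth constant and the slack riding along (`C ↦ {C with a := λ₀²a}`, `θ ↦ λ₀²θ`; `LiveFactorEndLetters` §2;
the unsplit slack's live form is `slack_live₁` here): `continuumYM4Torus_of_towerExtractionPriced_live` — END2's theorem with its
constants-only side conditions AT PRINT's LETTERS and a «count DERIVED» record OF THE LOWERED-THRESHOLD RUN for all small
couplings ⟹ `ContinuumYM4Torus D`.  NET: (L1-step) in END2's currency = instantiation (as file 9 for 2R); every «g small» END2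
needs at the live letters is produced inside it from `ForSmallCouplings`.

INPUTS LEFT (located, NOT discharged — as `LiveFactorTowerShell`): the realized ledgers for every grid assignment
((L1-levelwise)); (L2↓); (FD); floors; the window majorant; node O (the live record).  NE7c NOT proved.  HONEST DEPENDENCY
(cell): continuum YM on T⁴ ⇐ BetaPertH ∧ nine spine estimates (0∕9 proved); BetaPertH ⇐ (D1) ∧ (D4) ∧ CAP+tail.
-/

namespace Summit.QuantumFields.BalabanUV.T4Continuum.Spine.NE7c.LiveFactorTowerPriced

open Finset MeasureTheory
open Literature.MathematicalPhysics.QuantumFieldTheory.Balaban1983to89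
open Literature.MathematicalPhysics.QuantumFieldTheory.Balaban1983to89.T4ShellMeasure
open Literature.MathematicalPhysics.QuantumFieldTheory.Balaban1983to89.T4Continuum
open Summit.QuantumFields.BalabanUV.T4Continuum.HistoryConstants
open Summit.QuantumFields.BalabanUV.T4Continuum.B16HistoryIndexedRepr
open Summit.QuantumFields.BalabanUV.T4Continuum.B16HistoryIndexedTrunc
open Summit.QuantumFields.BalabanUV.T4Continuum.B16HistoryReprChain
open Summit.QuantumFields.BalabanUV.T4Continuum.B16HistoryReprInstance
open Summit.QuantumFields.BalabanUV.T4Continuum.B16HistoryTowerExtractionPricedDataLWR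
open Summit.QuantumFields.BalabanUV.T4Continuum.Spine.NE7c.LiveFactorGlobalCompact
open Summit.QuantumFields.BalabanUV.T4Continuum.Spine.NE7c.LiveFactorTowerShell

/-! ## §1 Against END2's record: the order of quantifiers of a threshold-parametric (A1c-0) builder -/

section Record

variable {F : T4Family} {G : Type*} [GaugeGroup G] [MeasurableSpace G] [HaarData G]
  {D : FiniteEpsData F G} {Cn : T4PrintedShapeBanking.Consts} {O : PrintedO1s} {θv : ℝ} {rr d n : ℕ}
  {hn : 0 < n} {g₀ : ℕ → ℝ} {os : List (ULoop F)} {cΛ M Φ β₀ : ℝ} {p₁ η η' κ κ₂ κᵥ : ℕ}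
  {P : Type} [DecidableEq P] {X : ℕ → ℕ → Type} {𝒢 : (K j : ℕ) → GoodClass (X K j)}
  [∀ K, MeasurableSpace (X K K)] {μ : (K : ℕ) → Measure (X K K)} [∀ K, IsFiniteMeasure (μ K)]

/-- **END2's RECORD FROM A THRESHOLD-PARAMETRIC BUILDER AND THE JUNCTION** (interface word J-δ∕IR1032; logically one
application).  A builder `build` that, for EVERY grid assignment `c` and ANY shell budget `Wsh` carrying the `shell` display
at the tower `T c` with shell parts `shA c ∕ shB c`, returns END2's record `TowerExtractionPricedDataLWR … P X 𝒢 μ` (every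
other field built at `T c`: the budget over the cores `weight − shA c`, `weightB − shB c`, the extraction displays, the PRICE
SENTENCES at print's shape price, print's per-step sentences), together with `LiveFactorTowerShell.towerShell_of_globalCompact`'s
output `∃ c, (∀ j, c j < nC j) ∧ ∃ Wsh, ShellWeightBound …`, inhabits the record — the component
`Nonempty (TowerExtractionPricedDataLWR …)` of END2's `hRead` for this tuned run and loop string.  What it pins (unchanged
from IR-103-1): the builder is parametric in the assignment over a FIXED `branch`, and the assignment is chosen BEFORE the
record is instantiated.  Nothing discharged. [folklore] -/
theorem nonempty_towerExtractionPriced_of_parametric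
    (T : (ℕ → ℕ) → (K : ℕ) → Tower P (X K) (𝒢 K)) (p₀ : ℕ → ℕ → P) (ρ₀ : (ℕ → ℕ) → (K : ℕ) → ℝ → X K 0 → ℝ)
    (hρ₀ : ∀ c K t, (𝒢 K 0).Gd (ρ₀ c K t)) (h0 : ∀ c K t x, 0 ≤ ρ₀ c K t x)
    (trunc : (c : ℕ → ℕ) → ℕ → HIndex.Idx (skelFam (T c) p₀) → HIndex.Idx (skelFam (T c) p₀))
    (nC : ℕ → ℕ) {l₀ : ℝ} (shA shB : (c : ℕ → ℕ) → ℕ → ℝ → HIndex.Idx (skelFam (T c) p₀) → ℝ)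
    (build : ∀ c : ℕ → ℕ, (∀ j, c j < nC j) → ∀ Wsh : ℕ → ℝ,
      T4IndicatorShell.ShellWeightBound l₀ (HIndex.termSet (skelFam (T c) p₀))
        (fun _ t => Repr172R.weight μ (reprFam (T c) p₀ (ρ₀ c) (hρ₀ c) (h0 c) (fun _ _ => 1) (fun _ _ => one_pos)) t)
        (weightB μ (reprFam (T c) p₀ (ρ₀ c) (hρ₀ c) (h0 c) (fun _ _ => 1) (fun _ _ => one_pos)) (trunc c))
        (shA c) (shB c) Wsh →
      TowerExtractionPricedDataLWR D Cn O θv rr d n hn g₀ os cΛ M Φ β₀ p₁ η η' κ κ₂ κᵥ P X 𝒢 μ)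
    (hshell : ∃ c : ℕ → ℕ, (∀ j, c j < nC j) ∧ ∃ Wsh : ℕ → ℝ,
      T4IndicatorShell.ShellWeightBound l₀ (HIndex.termSet (skelFam (T c) p₀))
        (fun _ t => Repr172R.weight μ (reprFam (T c) p₀ (ρ₀ c) (hρ₀ c) (h0 c) (fun _ _ => 1) (fun _ _ => one_pos)) t)
        (weightB μ (reprFam (T c) p₀ (ρ₀ c) (hρ₀ c) (h0 c) (fun _ _ => 1) (fun _ _ => one_pos)) (trunc c))
        (shA c) (shB c) Wsh) :
    Nonempty (TowerExtractionPricedDataLWR D Cn O θv rr d n hn g₀ os cΛ M Φ β₀ p₁ η η' κ κ₂ κᵥ P X 𝒢 μ) := by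
  obtain ⟨c, hc, Wsh, h⟩ := hshell
  exact ⟨build c hc Wsh h⟩

/-- **ONE CALL: MEMBER (δ-global-compact) AT THE TOWER ⇒ END2's RECORD**, for a threshold-parametric builder —
`LiveFactorTowerShell.towerShell_of_globalCompact` fed to `nonempty_towerExtractionPriced_of_parametric`.  Hypotheses: the
builder `build` and, verbatim, the located inputs of `LiveFactorGlobalCompact.shellWeightBound_of_globalCompact` at the tower's
carriers (realized slot ledgers per grid assignment, floors, (FD), (L2↓), covers, loss factors, window majorant).
Conclusion: the `hRead` component `Nonempty (TowerExtractionPricedDataLWR …)` of END2's road for this tuned run and loop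
string.  Nothing discharged; NE7c NOT proved (INSTANCE 0∕1: the builder is node O's). [folklore] -/
theorem nonempty_towerExtractionPriced_of_globalCompact
    (T : (ℕ → ℕ) → (K : ℕ) → Tower P (X K) (𝒢 K)) (hbr : ∀ c c' K, (T c K).branch = (T c' K).branch)
    (p₀ : ℕ → ℕ → P) (ρ₀ : (ℕ → ℕ) → (K : ℕ) → ℝ → X K 0 → ℝ)
    (hρ₀ : ∀ c K t, (𝒢 K 0).Gd (ρ₀ c K t)) (h0 : ∀ c K t x, 0 ≤ ρ₀ c K t x)
    (trunc : (c : ℕ → ℕ) → ℕ → HIndex.Idx (skelFam (T c) p₀) → HIndex.Idx (skelFam (T c) p₀))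
    {l₀ a C ϑ : ℝ} (nC : ℕ → ℕ) (hnC : ∀ j, 0 < nC j) (B W : ℕ → Finset ℕ) (hWB : ∀ K j, j ∈ W K → K ∈ B j)
    {σ σ' : Type*} (shA shB : (c : ℕ → ℕ) → ℕ → ℝ → HIndex.Idx (skelFam (T c) p₀) → ℝ)
    (SA : ℕ → Finset σ) (SB : ℕ → Finset σ')
    (pieceA : (c : ℕ → ℕ) → ℕ → ℝ → σ → HIndex.Idx (skelFam (T c) p₀) → ℝ)
    (pieceB : (c : ℕ → ℕ) → ℕ → ℝ → σ' → HIndex.Idx (skelFam (T c) p₀) → ℝ)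
    (build : ∀ c : ℕ → ℕ, (∀ j, c j < nC j) → ∀ Wsh : ℕ → ℝ,
      T4IndicatorShell.ShellWeightBound l₀ (HIndex.termSet (skelFam (T c) p₀))
        (fun _ t => Repr172R.weight μ (reprFam (T c) p₀ (ρ₀ c) (hρ₀ c) (h0 c) (fun _ _ => 1) (fun _ _ => one_pos)) t)
        (weightB μ (reprFam (T c) p₀ (ρ₀ c) (hρ₀ c) (h0 c) (fun _ _ => 1) (fun _ _ => one_pos)) (trunc c))
        (shA c) (shB c) Wsh →
      TowerExtractionPricedDataLWR D Cn O θv rr d n hn g₀ os cΛ M Φ β₀ p₁ η η' κ κ₂ κᵥ P X 𝒢 μ)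
    (hLA : ∀ c : ℕ → ℕ, (∀ j, c j < nC j) →
      SlotLedger l₀ (HIndex.termSet (skelFam (T c) p₀))
        (fun _ t => Repr172R.weight μ (reprFam (T c) p₀ (ρ₀ c) (hρ₀ c) (h0 c) (fun _ _ => 1) (fun _ _ => one_pos)) t)
        (shA c) SA (pieceA c)
        (fun K s => Real.exp (2 * a) *
          ((∑ τ ∈ HIndex.termSet (skelFam (T c) p₀) K, pieceA c K 0 s τ) /
            ∑ τ ∈ HIndex.termSet (skelFam (T c) p₀) K,
              Repr172R.weight μ (reprFam (T c) p₀ (ρ₀ c) (hρ₀ c) (h0 c) (fun _ _ => 1) (fun _ _ => one_pos)) 0 τ)))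
    (hLB : ∀ c : ℕ → ℕ, (∀ j, c j < nC j) →
      SlotLedger l₀ (HIndex.termSet (skelFam (T c) p₀))
        (weightB μ (reprFam (T c) p₀ (ρ₀ c) (hρ₀ c) (h0 c) (fun _ _ => 1) (fun _ _ => one_pos)) (trunc c))
        (shB c) SB (pieceB c)
        (fun K s => Real.exp (2 * a) *
          ((∑ τ ∈ HIndex.termSet (skelFam (T c) p₀) K, pieceB c K 0 s τ) /
            ∑ τ ∈ HIndex.termSet (skelFam (T c) p₀) K,
              weightB μ (reprFam (T c) p₀ (ρ₀ c) (hρ₀ c) (h0 c) (fun _ _ => 1) (fun _ _ => one_pos)) (trunc c) K 0 τ)))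
    {ZA ZB : ℕ → ℝ} (hZA : ∀ K, 0 < ZA K) (hZB : ∀ K, 0 < ZB K)
    (hZAle : ∀ c : ℕ → ℕ, (∀ j, c j < nC j) → ∀ K,
      ZA K ≤ ∑ τ ∈ HIndex.termSet (skelFam (T c) p₀) K,
        Repr172R.weight μ (reprFam (T c) p₀ (ρ₀ c) (hρ₀ c) (h0 c) (fun _ _ => 1) (fun _ _ => one_pos)) 0 τ)
    (hZBle : ∀ c : ℕ → ℕ, (∀ j, c j < nC j) → ∀ K,
      ZB K ≤ ∑ τ ∈ HIndex.termSet (skelFam (T c) p₀) K,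
        weightB μ (reprFam (T c) p₀ (ρ₀ c) (hρ₀ c) (h0 c) (fun _ _ => 1) (fun _ _ => one_pos)) (trunc c) K 0 τ)
    (wA wB : ℕ → ℕ → (ℕ → ℕ) → ℝ) (hA0 : ∀ K j c, 0 ≤ wA K j c) (hB0 : ∀ K j c, 0 ≤ wB K j c)
    (Dp : ℕ → ℕ → ℕ)
    (hdepA : ∀ K j (c c' : ℕ → ℕ), (∀ l, c l < nC l) → (∀ l, c' l < nC l) → (∀ l, l < Dp K j → c l = c' l) →
      wA K j c = wA K j c')
    (hdepB : ∀ K j (c c' : ℕ → ℕ), (∀ l, c l < nC l) → (∀ l, c' l < nC l) → (∀ l, l < Dp K j → c l = c' l) →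
      wB K j c = wB K j c')
    (V : ℕ → ℝ) (hV : ∀ j, 0 ≤ V j)
    (hA : ∀ K j (c : ℕ → ℕ), (∀ l, c l < nC l) →
      ∑ m ∈ range (nC j), wA K j (Function.update c j m) ≤ V j * ZA K)
    (hB : ∀ K j (c : ℕ → ℕ), (∀ l, c l < nC l) →
      ∑ m ∈ range (nC j), wB K j (Function.update c j m) ≤ V j * ZB K)
    (hcovA : ∀ c : ℕ → ℕ, (∀ j, c j < nC j) → ∀ K,
      ∑ s ∈ SA K, ∑ τ ∈ HIndex.termSet (skelFam (T c) p₀) K, pieceA c K 0 s τ ≤ ∑ j ∈ W K, wA K j c)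
    (hcovB : ∀ c : ℕ → ℕ, (∀ j, c j < nC j) → ∀ K,
      ∑ s ∈ SB K, ∑ τ ∈ HIndex.termSet (skelFam (T c) p₀) K, pieceB c K 0 s τ ≤ ∑ j ∈ W K, wB K j c)
    (t : ℕ → ℝ) (ht0 : ∀ j, 0 < t j) (ht : ∀ J, ∑ j ∈ range J, (t j)⁻¹ < 1)
    (hϑ0 : 0 ≤ ϑ) (hϑ1 : ϑ < 1)
    (hgeo : ∀ K, ∑ j ∈ W K, t j * (2 * ((B j).card : ℝ) * V j / nC j) ≤ C * ϑ ^ K) :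
    Nonempty (TowerExtractionPricedDataLWR D Cn O θv rr d n hn g₀ os cΛ M Φ β₀ p₁ η η' κ κ₂ κᵥ P X 𝒢 μ) :=
  nonempty_towerExtractionPriced_of_parametric T p₀ ρ₀ hρ₀ h0 trunc nC shA shB build
    (towerShell_of_globalCompact μ T hbr p₀ ρ₀ hρ₀ h0 trunc nC hnC B W hWB shA shB SA SB pieceA pieceB hLA hLB
      hZA hZB hZAle hZBle wA wB hA0 hB0 Dp hdepA hdepB V hV hA hB hcovA hcovB t ht0 ht hϑ0 hϑ1 hgeo)

end Record


/-! ## §2 END2's ROAD at road (δ)'s live letters: one moved letter, one `exact` -/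

section End2Live

open T4PrintedShapeBanking T4CanonicalMenus
open Summit.QuantumFields.BalabanUV.T4Continuum.HistoryZoneEvolve (cth)
open Summit.QuantumFields.BalabanUV.T4Continuum.CountThresholdUniform
open Summit.QuantumFields.BalabanUV.T4Continuum.B16HistoryTowerExtractionEnd2
open Summit.QuantumFields.BalabanUV.T4Continuum.Spine.NE7c.LiveFactorEndLetters

variable {lam₀ : ℝ}

/-- **THE UNSPLIT SLACK AT THE LIVE LETTERS** (END2 keeps 2R's unsplit `C.a + θ ≤ ½γ₀A₁²`): multiplying by `λ₀²`,
`(λ₀²·C.a) + λ₀²θ ≤ ½(λ₀²γ₀)A₁²` — the slack of the live constants `{C with a := λ₀²a}`, `{O with γ₀ := λ₀²γ₀}` at `λ₀²θ`. [folklore] -/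
theorem slack_live₁ (C : T4PrintedShapeBanking.Consts) (O : PrintedO1s) {θ : ℝ} (h : C.a + θ ≤ O.γ₀ * O.A₁ ^ 2 / 2) :
    ({ C with a := lam₀ ^ 2 * C.a } : T4PrintedShapeBanking.Consts).a + lam₀ ^ 2 * θ ≤
      ({ O with γ₀ := lam₀ ^ 2 * O.γ₀ } : PrintedO1s).γ₀ * O.A₁ ^ 2 / 2 := by
  show lam₀ ^ 2 * C.a + lam₀ ^ 2 * θ ≤ lam₀ ^ 2 * O.γ₀ * O.A₁ ^ 2 / 2
  nlinarith [mul_le_mul_of_nonneg_left h (sq_nonneg lam₀)]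

variable {F : T4Family} {N : ℕ} [NeZero N] {ℰ : LoopAverage (Matrix.specialUnitaryGroup (Fin N) ℂ)}

/-- **END2 AT THE TOWER («count DERIVED»), AT ROAD (δ)'s LIVE LETTERS.**  For (0.4)-block-averaged data on `SU(N)` with a
measurable small-loop average, GIVEN (B) and `BetaPertHyp` BY NAME, the `_fsc` family's constants-only side conditions AT
PRINT's LETTERS (`ThresholdOK C …`, the unsplit slack `C.a + θ ≤ ½γ₀A₁²`, …), and — for all small-coupling tuned runs and every
loop string — SOME «count DERIVED» tower record OF THE LOWERED-THRESHOLD RUN, i.e. END2's record at the live letters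
`TowerExtractionPricedDataLWR D {C with a := λ₀²a} {O with γ₀ := λ₀²γ₀} θv' …` (price sentences at the live shape price,
extraction displays and the NE7c ∕ NE7 rows of the live run — node O's to build exactly as for print's run, threshold-parametrically
per §1), the headline predicate `ContinuumYM4Torus D` holds.  Proof: leaf-06's `continuumYM4Torus_of_towerExtractionPriced_fsc`
AT the live letters, `ThresholdOK` and the slack supplied by `LiveFactorEndLetters.thresholdOK_live` ∕ `slack_live₁`, every other
side condition letter-blind.  CONDITIONAL on everything the live record displays; NE7c ∕ NE7b NOT proved; count 0∕9. [folklore] -/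
theorem continuumYM4Torus_of_towerExtractionPriced_live (D : FiniteEpsData F (Matrix.specialUnitaryGroup (Fin N) ℂ))
    (hBA : D.IsBlockAveraged ℰ) (hE : ℰ.MeasurableE) (hB : B16.EndStatementBPrinted D.C) (hβ : BetaPertHyp D.βfun)
    (h0 : 0 < lam₀) {C : T4PrintedShapeBanking.Consts} {O : PrintedO1s}
    {rr : ℕ} {β₀ : ℝ} (h : ThresholdOK C F.L rr β₀) (hμ : 0 < C.μ) (d n : ℕ)
    (hκ₁ : (d : ℝ) * Real.log F.L + 2 * Real.log 2 ≤ C.κ₁) (hE₀ : Real.log (2 + birthMass C) ≤ C.E₀)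
    (hA₀ : 1 ≤ C.A₀) (hβ₀ : 0 < β₀) (hLβ : (F.L : ℝ) * β₀ ≤ 1) (hn₁ : 13 ≤ C.n₁) (hn : 0 < n)
    {θ : ℝ} (hθ : 0 < θ) (hslack : C.a + θ ≤ O.γ₀ * O.A₁ ^ 2 / 2)
    (hE₂ : 0 < C.E₂) (hE₃ : 0 ≤ C.E₃) {sS : ℕ} (hsS : 1 ≤ sS)
    (hsmall : (((2 * cth 32 1 sS + 1) ^ d : ℕ) : ℝ) * (5 : ℝ) ^ d * ((max 1 (2 * 32 + 2) : ℕ) : ℝ) ≤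
      (F.L : ℝ) ^ (sS / 2) / 2)
    {θc : ℝ} (hθc0 : 0 ≤ θc) (hθc1 : θc < 1) (hθcs : 1 / 2 ≤ θc ^ sS)
    {θv' cΛ M Φ b₀ : ℝ} {p₁ η η' κ κ₂ κᵥ : ℕ}
    (hRead : T4ContinuumYM4Torus.ForSmallCouplings D fun g₀ => ∀ os : List (ULoop F),
      ∃ (P : Type) (_ : DecidableEq P) (X : ℕ → ℕ → Type) (𝒢 : (K j : ℕ) → GoodClass (X K j))
        (_ : ∀ K, MeasurableSpace (X K K)) (μ : (K : ℕ) → Measure (X K K)) (_ : ∀ K, IsFiniteMeasure (μ K)),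
        Nonempty (TowerExtractionPricedDataLWR D { C with a := lam₀ ^ 2 * C.a } { O with γ₀ := lam₀ ^ 2 * O.γ₀ } θv'
          rr d n hn g₀ os cΛ M Φ b₀ p₁ η η' κ κ₂ κᵥ P X 𝒢 μ)) :
    T4ContinuumYM4Torus.ContinuumYM4Torus D :=
  continuumYM4Torus_of_towerExtractionPriced_fsc D hBA hE hB hβ (thresholdOK_live h0 h) hμ d n hκ₁ hE₀ hA₀ hβ₀ hLβ hn₁ hn
    (slack_pos_live h0 hθ) (slack_live₁ C O hslack) hE₂ hE₃ hsS hsmall hθc0 hθc1 hθcs hRead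

end End2Live

end Summit.QuantumFields.BalabanUV.T4Continuum.Spine.NE7c.LiveFactorTowerPriced
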